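import Mathlib
import Literature.Combinatorics.Additive.TripleProductProperty

/-!
# `SnSubsetDichotomy.HyperoctahedralSubsets`, line `spherical-rank-sieve` — stub `stub_groupPacking`

Group packing, the 3-wise packing lemma (crux `stmt-MatrixMultiplication-8305`, registered stub
`stub_groupPacking` of the lead's skeleton for line `spherical-rank-sieve`).

Let `μ₀, μ₁, μ₂` be permutations of `Fin n` with centralisers `C(μ_i) = {σ : σ μ_i = μ_i σ}`
(the `Finset`s `univ.filter (σ * μ i = μ i * σ)`), let `X_i ⊆ C(μ_i)` have the triple product
property (tree convention `Literature.Combinatorics.Additive.TripleProductProperty`: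
`s s'⁻¹ (t t'⁻¹) (u u'⁻¹) = 1 ⇒ s = s', t = t', u = u'`), and let `T` be a finite set of triples of
permutations containing `1` and closed under componentwise product and inverse (a subgroup of
`(S_n)³`), every element `(a, b, c)` of which is hosted (`a ∈ C(μ₀)`, `b ∈ C(μ₁)`, `c ∈ C(μ₂)`) and
has product one (`abc = 1`).  Then `|X₀||X₁||X₂| · |T| ≤ |C(μ₀)||C(μ₁)||C(μ₂)|`.

Proof (`card_mul_card_le_of_tpp_of_hosted`, stated for an abstract group `P` and abstract "host"
sets `C_i` closed under `(a, b) ↦ a⁻¹ b`).  The map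
`T³ × X₀ × X₁ × X₂ → (C₀ × C₁ × C₂) × T²`,
`(d₀, d₁, d₂, x₀, x₁, x₂) ↦ ((a_{d₀}⁻¹ x₀, b_{d₁}⁻¹ x₁, c_{d₂}⁻¹ x₂), (d₀⁻¹ d₁, d₁⁻¹ d₂))`
(writing `d = (a_d, b_d, c_d)`) is well defined because the hosts are closed under `a⁻¹ b`, and it is
injective: a collision forces `d_i' = δ d_i` (`i = 0, 1, 2`) for the single element
`δ = d₀' d₀⁻¹ ∈ T`, and then `x₀' x₀⁻¹ = δ.1`, `x₁' x₁⁻¹ = δ.2.1`, `x₂' x₂⁻¹ = δ.2.2`, whose product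
is `1` — a triple-product relation, so `x_i' = x_i`, `δ = 1` and `d_i' = d_i`
(`Finset.card_le_card_of_injOn`).  Hence `|T|³ · vol ≤ |C₀||C₁||C₂| · |T|²`, and `|T| > 0` (`1 ∈ T`)
cancels two factors `|T|`.  No involution or fixed-point-freeness hypothesis is used; the bound is
sharp at `n = 4` (`K₄` one-factorisation, `|T| = 16`, `vol = 32 = 8³/16`).

References: Cohn–Umans 2003, Lemma 3.1 (the case `T = 1`, pairwise packing); the 3-wise version is
this line's.
-/

namespace Summit.MatrixMultiplication.MatrixMultiplication.Theorems.HyperoctahedralSubsets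

open Literature.Combinatorics.Additive

/-- **Centraliser `Finset`s are closed under `(a, b) ↦ a⁻¹ b`.**  In a finite group `P`, if `a` and
`b` commute with `μ` then so does `a⁻¹ b` (the centraliser of `μ` is a subgroup), phrased for the
`Finset` `univ.filter (σ * μ = μ * σ)`. [folklore] -/
theorem inv_mul_mem_filter_comm {P : Type*} [Group P] [Fintype P] [DecidableEq P] (μ : P) :
    ∀ a ∈ Finset.univ.filter (fun σ : P => σ * μ = μ * σ),
      ∀ b ∈ Finset.univ.filter (fun σ : P => σ * μ = μ * σ),
        a⁻¹ * b ∈ Finset.univ.filter (fun σ : P => σ * μ = μ * σ) := by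
  intro a ha b hb
  simp only [Finset.mem_filter, Finset.mem_univ, true_and] at ha hb ⊢
  have ha' : Commute a μ := ha
  have hb' : Commute b μ := hb
  exact (ha'.inv_left.mul_left hb').eq

/-- **Group packing in an abstract group** (the 3-wise packing lemma).  Let `P` be a group,
`C₀, C₁, C₂ ⊆ P` finite "host" sets closed under `(a, b) ↦ a⁻¹ b`, `X_i ⊆ C_i` a triple with the
triple product property, and `T ⊆ P³` a non-empty finite set closed under componentwise product and
inverse whose elements `(a, b, c)` satisfy `a ∈ C₀`, `b ∈ C₁`, `c ∈ C₂` and `abc = 1`.  Then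
`|X₀||X₁||X₂| · |T| ≤ |C₀||C₁||C₂|`: the map
`(d₀, d₁, d₂, x₀, x₁, x₂) ↦ ((a_{d₀}⁻¹ x₀, b_{d₁}⁻¹ x₁, c_{d₂}⁻¹ x₂), (d₀⁻¹ d₁, d₁⁻¹ d₂))` from
`T³ × X₀ × X₁ × X₂` to `(C₀ × C₁ × C₂) × T²` is injective by the triple product property, so
`|T|³ · vol ≤ |C₀||C₁||C₂| · |T|²`. (Cohn–Umans 2003, Lemma 3.1 is the case `T = 1`.) [folklore] -/
theorem card_mul_card_le_of_tpp_of_hosted {P : Type*} [Group P]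
    {C₀ C₁ C₂ X₀ X₁ X₂ : Finset P} {T : Finset (P × P × P)}
    (hX₀ : X₀ ⊆ C₀) (hX₁ : X₁ ⊆ C₁) (hX₂ : X₂ ⊆ C₂)
    (hC₀ : ∀ a ∈ C₀, ∀ b ∈ C₀, a⁻¹ * b ∈ C₀) (hC₁ : ∀ a ∈ C₁, ∀ b ∈ C₁, a⁻¹ * b ∈ C₁)
    (hC₂ : ∀ a ∈ C₂, ∀ b ∈ C₂, a⁻¹ * b ∈ C₂)
    (hTPP : TripleProductProperty X₀ X₁ X₂)
    (hmul : ∀ s ∈ T, ∀ t ∈ T, s * t ∈ T) (hinv : ∀ t ∈ T, t⁻¹ ∈ T) (hT : T.Nonempty)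
    (hhost : ∀ t ∈ T, t.1 ∈ C₀ ∧ t.2.1 ∈ C₁ ∧ t.2.2 ∈ C₂ ∧ t.1 * t.2.1 * t.2.2 = 1) :
    X₀.card * X₁.card * X₂.card * T.card ≤ C₀.card * C₁.card * C₂.card := by
  -- the packing map, on `T³ × (X₀ × X₁ × X₂)` with values in `(C₀ × C₁ × C₂) × (T × T)`
  obtain ⟨Φ, hΦ⟩ : ∃ Φ : (P × P × P) × (P × P × P) × (P × P × P) × P × P × P →
      (P × P × P) × (P × P × P) × (P × P × P),
      ∀ d, Φ d = ((d.1.1⁻¹ * d.2.2.2.1, d.2.1.2.1⁻¹ * d.2.2.2.2.1, d.2.2.1.2.2⁻¹ * d.2.2.2.2.2),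
        d.1⁻¹ * d.2.1, d.2.1⁻¹ * d.2.2.1) :=
    ⟨_, fun _ => rfl⟩
  have hmaps : Set.MapsTo Φ ↑(T ×ˢ T ×ˢ T ×ˢ (X₀ ×ˢ X₁ ×ˢ X₂)) ↑((C₀ ×ˢ C₁ ×ˢ C₂) ×ˢ T ×ˢ T) := by
    rintro ⟨d₀, d₁, d₂, x₀, x₁, x₂⟩ hd
    simp only [Finset.coe_product, Set.mem_prod, Finset.mem_coe] at hd
    obtain ⟨hd₀, hd₁, hd₂, hx₀, hx₁, hx₂⟩ := hd
    simp only [hΦ, Finset.coe_product, Set.mem_prod, Finset.mem_coe]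
    exact ⟨⟨hC₀ _ (hhost _ hd₀).1 _ (hX₀ hx₀), hC₁ _ (hhost _ hd₁).2.1 _ (hX₁ hx₁),
      hC₂ _ (hhost _ hd₂).2.2.1 _ (hX₂ hx₂)⟩, hmul _ (hinv _ hd₀) _ hd₁, hmul _ (hinv _ hd₁) _ hd₂⟩
  have hinj : Set.InjOn Φ ↑(T ×ˢ T ×ˢ T ×ˢ (X₀ ×ˢ X₁ ×ˢ X₂)) := by
    rintro ⟨d₀, d₁, d₂, x₀, x₁, x₂⟩ hd ⟨d₀', d₁', d₂', x₀', x₁', x₂'⟩ hd' he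
    simp only [Finset.coe_product, Set.mem_prod, Finset.mem_coe] at hd hd'
    obtain ⟨hd₀, -, -, hx₀, hx₁, hx₂⟩ := hd
    obtain ⟨hd₀', -, -, hx₀', hx₁', hx₂'⟩ := hd'
    simp only [hΦ, Prod.mk.injEq] at he
    obtain ⟨⟨e₀, e₁, e₂⟩, e₃, e₄⟩ := he
    -- all three `d_i'` differ from `d_i` by the same left factor `δ := d₀' d₀⁻¹ ∈ T`
    have h₁ : d₁' = d₀' * d₀⁻¹ * d₁ := by rw [mul_assoc, e₃, mul_inv_cancel_left]
    have h₂ : d₂' = d₀' * d₀⁻¹ * d₂ := by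
      calc d₂' = d₁' * (d₁'⁻¹ * d₂') := (mul_inv_cancel_left _ _).symm
        _ = d₀' * d₀⁻¹ * d₁ * (d₁⁻¹ * d₂) := by rw [← e₄, ← h₁]
        _ = d₀' * d₀⁻¹ * d₂ := by rw [mul_assoc, mul_inv_cancel_left]
    obtain ⟨δ, hδ, hδ₀, hδ₁, hδ₂⟩ :
        ∃ δ ∈ T, d₀' = δ * d₀ ∧ d₁' = δ * d₁ ∧ d₂' = δ * d₂ :=
      ⟨d₀' * d₀⁻¹, hmul _ hd₀' _ (hinv _ hd₀), (inv_mul_cancel_right _ _).symm, h₁, h₂⟩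
    clear h₁ h₂ e₃ e₄
    subst hδ₀ hδ₁ hδ₂
    -- the first block: `x_i' x_i⁻¹` are the components of `δ`
    simp only [Prod.fst_mul, Prod.snd_mul, mul_inv_rev, mul_assoc, mul_right_inj] at e₀ e₁ e₂
    have q₀ : x₀' * x₀⁻¹ = δ.1 := by rw [e₀, mul_inv_rev, inv_inv, mul_inv_cancel_left]
    have q₁ : x₁' * x₁⁻¹ = δ.2.1 := by rw [e₁, mul_inv_rev, inv_inv, mul_inv_cancel_left]
    have q₂ : x₂' * x₂⁻¹ = δ.2.2 := by rw [e₂, mul_inv_rev, inv_inv, mul_inv_cancel_left]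
    have key : x₀' * x₀⁻¹ * (x₁' * x₁⁻¹) * (x₂' * x₂⁻¹) = 1 := by
      rw [q₀, q₁, q₂]; exact (hhost δ hδ).2.2.2
    obtain ⟨rfl, rfl, rfl⟩ := hTPP x₀' hx₀' x₀ hx₀ x₁' hx₁' x₁ hx₁ x₂' hx₂' x₂ hx₂ key
    rw [mul_inv_cancel] at q₀ q₁ q₂
    have hδ1 : δ = 1 := Prod.ext q₀.symm (Prod.ext q₁.symm q₂.symm)
    subst hδ1
    simp only [one_mul]
  have hle := Finset.card_le_card_of_injOn Φ hmaps hinj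
  have hTpos : 0 < T.card := Finset.card_pos.2 hT
  have key : X₀.card * X₁.card * X₂.card * T.card * (T.card * T.card) ≤
      C₀.card * C₁.card * C₂.card * (T.card * T.card) := by
    calc X₀.card * X₁.card * X₂.card * T.card * (T.card * T.card)
        = (T ×ˢ T ×ˢ T ×ˢ (X₀ ×ˢ X₁ ×ˢ X₂)).card := by
          simp only [Finset.card_product]; ring
      _ ≤ ((C₀ ×ˢ C₁ ×ˢ C₂) ×ˢ T ×ˢ T).card := hle
      _ = C₀.card * C₁.card * C₂.card * (T.card * T.card) := by
          simp only [Finset.card_product]; ring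
  exact le_of_mul_le_mul_right key (Nat.mul_pos hTpos hTpos)

/-- **Stub `stub_groupPacking` — group packing inside the three hosts** (line `spherical-rank-sieve`
of crux `SnSubsetDichotomy.HyperoctahedralSubsets`, stmt-MatrixMultiplication-8305).  For
permutations `μ₀, μ₁, μ₂` of `Fin n`, sets `X_i` of permutations commuting with `μ_i` and having the
triple product property, and a finite set `T` of triples of permutations containing `1`, closed
under componentwise product and inverse, all of whose elements `(a, b, c)` are hosted
(`a μ₀ = μ₀ a`, `b μ₁ = μ₁ b`, `c μ₂ = μ₂ c`) with `abc = 1`: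
`|X₀||X₁||X₂| · |T| ≤ |C(μ₀)||C(μ₁)||C(μ₂)|`, `C(μ) = univ.filter (σ μ = μ σ)`.  Immediate from
`card_mul_card_le_of_tpp_of_hosted` with `C_i := C(μ_i)` (closed under `a⁻¹ b` by
`inv_mul_mem_filter_comm`). [folklore] -/
theorem stub_groupPacking : ∀ (n : ℕ) (μ : Fin 3 → Equiv.Perm (Fin n)) (X : Fin 3 → Finset (Equiv.Perm (Fin n))) (T : Finset (Equiv.Perm (Fin n) × Equiv.Perm (Fin n) × Equiv.Perm (Fin n))), (∀ i, ∀ σ ∈ X i, σ * μ i = μ i * σ) → Literature.Combinatorics.Additive.TripleProductProperty (X 0) (X 1) (X 2) → (1 : Equiv.Perm (Fin n) × Equiv.Perm (Fin n) × Equiv.Perm (Fin n)) ∈ T → (∀ s ∈ T, ∀ t ∈ T, s * t ∈ T) → (∀ t ∈ T, t⁻¹ ∈ T) → (∀ t ∈ T, t.1 * μ 0 = μ 0 * t.1 ∧ t.2.1 * μ 1 = μ 1 * t.2.1 ∧ t.2.2 * μ 2 = μ 2 * t.2.2 ∧ t.1 * t.2.1 * t.2.2 = 1) → (X 0).card * (X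 1).card * (X 2).card * T.card ≤ (Finset.univ.filter (fun σ : Equiv.Perm (Fin n) => σ * μ 0 = μ 0 * σ)).card * (Finset.univ.filter (fun σ : Equiv.Perm (Fin n) => σ * μ 1 = μ 1 * σ)).card * (Finset.univ.filter (fun σ : Equiv.Perm (Fin n) => σ * μ 2 = μ 2 * σ)).card := by
  intro n μ X T hX hTPP h1 hmul hinv hhost
  have hsub : ∀ i, X i ⊆ Finset.univ.filter (fun σ : Equiv.Perm (Fin n) => σ * μ i = μ i * σ) :=
    fun i σ hσ => Finset.mem_filter.2 ⟨Finset.mem_univ _, hX i σ hσ⟩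
  refine card_mul_card_le_of_tpp_of_hosted (hsub 0) (hsub 1) (hsub 2)
    (inv_mul_mem_filter_comm (μ 0)) (inv_mul_mem_filter_comm (μ 1))
    (inv_mul_mem_filter_comm (μ 2)) hTPP hmul hinv ⟨1, h1⟩ fun t ht => ?_
  obtain ⟨h₀, h₁, h₂, h₃⟩ := hhost t ht
  exact ⟨Finset.mem_filter.2 ⟨Finset.mem_univ _, h₀⟩, Finset.mem_filter.2 ⟨Finset.mem_univ _, h₁⟩,
    Finset.mem_filter.2 ⟨Finset.mem_univ _, h₂⟩, h₃⟩

end Summit.MatrixMultiplication.MatrixMultiplication.Theorems.HyperoctahedralSubsets
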